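import Summits.HodgeConjecture.CorCM.MultiFieldWeilSharedQuadraticFamilies
import Summits.HodgeConjecture.CorCM.MultiFieldWeilPairAdditiveGluing
import Summits.HodgeConjecture.CorCM.SimpleCMProductsDimLeThreeHodge
import Literature.AlgebraicGeometry.ComplexMultiplication.SimpleCMAbelianVarietyIsogenyClasses
import HarnessLib

/-!
# MULTI-FIELD WEIL ENGINE — NO CLOSURE TRIPLE: simple CM abelian varieties of dimension `≤ 3` whose threefolds sharing an imaginary quadratic field have non-isomorphic
# fields, with no three threefolds in one Galois closure and no dihedral surface triple — the Hodge conjecture for every product of copies, given ONLY Markman 4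

Cell `pub-hodgecm2` (COR-CM), seat b30 gen 36 (2026-08-25); count-neutral own lane MULTI-FIELD WEIL ENGINE (stem `MultiFieldWeil*`).  Theorems only; no definition, no named
fact, no `sorry`.  HONEST FRAMING: conditional ONLY on `Markman2025_weilClasses_algebraic_abelianFourfold`; `HC_CM` is NOT proved and not asserted.
**`hodgeConjectureFor_prod_of_noClosureTriple_of_markman`**: `A_i ⊨ (K_i; Φ_i)` (`i ∈ I` finite) SIMPLE of dimension `≤ 3` with (A) two distinct sextic slots whose fields
SHARE an imaginary quadratic field have NO ring homomorphism between them; (B) NO THREE pairwise distinct sextic slots in one Galois closure; (iii′) among three quartic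
slots with one closure two carry isogenous surfaces ⟹ HC for EVERY product of copies `⨁_j A_{π j}`.  This CONTAINS `CorCM/MultiFieldWeilSharedQuadraticFamilies.lean`
(whose (Q2) forbade equal closures for every non-sharing pair): sisters `k·F`, `k′·F`, two types of one field without imaginary quadratic subfield, two non-isomorphic such
fields in one closure are now allowed — each a nondegenerate pair (seat b16's census), i.e. an ADDITIVE EXCEPTIONAL PAIR of `CorCM/MultiFieldWeilPairAdditiveGluing.lean`,
isolated by (B).  Blocks: classes of «isomorphic fields or sharing» (k-groups → W2's group block; ≤ 2 slots of one no-k field → `threefoldBlock`) + the surface block; cross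
pairs by b16's pair kit, `pairwise_of_isEmpty`, or the census on the pair sub-family.
[cite: MoonenZarhin1999LowDim, Thm. (0.1), Thm. (0.2), §3 (3.1), Cor. (3.9)] [cite: Markman2025SurveySecant, Thm. 1.2] [cite: Dodson1984, §5.1.2 Theorem]
[cite: Gordon1999HodgeAVSurvey, §3 Theorem (proof), 7.4–7.7, 9.4] [cite: Shimura1998, §5.2, §8.1, §8.4] [cite: MilneCM2006, Ch. I Prop. 3.13] [cite: MumfordAV1970, §19]

## References
* [MoonenZarhin1999LowDim] B. Moonen, Yu. Zarhin, Math. Ann. 315 (1999).  [Markman2025SurveySecant] E. Markman, arXiv:2509.23403.  [Dodson1984] B. Dodson, Trans. AMS 283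
  (1984).  [Gordon1999HodgeAVSurvey] B. B. Gordon, survey.  [Shimura1998] G. Shimura, CM book §5.2, §8.  [MilneCM2006] J. S. Milne, *Complex Multiplication*.  [MumfordAV1970] §19.
-/

noncomputable section

open CategoryTheory CategoryTheory.Limits NumberField IntermediateField

namespace Summit.HodgeConjecture.CorCM.MultiFieldWeil

open Finset Literature.NumberTheory.ComplexMultiplication
open Literature.AlgebraicGeometry Literature.AlgebraicGeometry.Motives Literature.AlgebraicGeometry.HodgeTheory
open Literature.AlgebraicGeometry.ComplexMultiplication (IsCMTypeRealisation exists_ringEquiv_forall_mem_iff_of_isIsogenous)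
open Literature.AlgebraicTopology.SingularHomology Literature.AlgebraicGeometry.Pohlmann1968

open scoped Classical

variable {I : Type} {K : I → Type} [∀ i, Field (K i)] [∀ i, NumberField (K i)] [∀ i, IsCMField (K i)]
  {Φ : ∀ i, CMType (K i)} {A : I → AbelianVariety ℂ} {ι : ∀ i, 𝓞 (K i) →+* End (A i)} {θ : ∀ i, K i →+* Module.End ℂ (complexBetti (A i).X 1)}

omit [∀ i, IsCMField (K i)] in
/-- The CM field of a realisation of dimension `≤ 3` has degree `2`, `4` or `6`. [cite: Shimura1998, §5.2] -/
private theorem finrank_eq_or_of_dim_le_three₃₆n (hA : ∀ i, IsCMTypeRealisation (Φ i) (A i) (ι i) (θ i)) {i : I} (h3 : (A i).dim ≤ 3) :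
    Module.finrank ℚ (K i) = 2 ∨ Module.finrank ℚ (K i) = 4 ∨ Module.finrank ℚ (K i) = 6 := by
  have h := finrank_eq_two_mul_dim_of_isCMTypeRealisation (hA i); have hpos : 0 < Module.finrank ℚ (K i) := Module.finrank_pos
  interval_cases hd : (A i).dim <;> omega

omit [∀ i, IsCMField (K i)] in
/-- An embedding of number fields `K_i ↪ K_t` makes `[K_i : ℚ]` divide `[K_t : ℚ]`. [cite: Shimura1998, §8.1] -/
private theorem finrank_dvd_of_ringHom₃₆n {i t : I} (g : K i →+* K t) : Module.finrank ℚ (K i) ∣ Module.finrank ℚ (K t) := by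
  have h1 : Module.finrank ℚ ↥g.toRatAlgHom.fieldRange = Module.finrank ℚ (K i) :=
    ((AlgEquiv.ofInjectiveField g.toRatAlgHom).toLinearEquiv.finrank_eq).symm
  rw [← h1, ← IntermediateField.finrank_top' (F := ℚ) (E := K t)]
  exact IntermediateField.finrank_dvd_of_le_right le_top

omit [∀ i, IsCMField (K i)] in
/-- **A homomorphism between number fields of the same degree is invertible.** [cite: Lang2002, V §1 Prop. 1.2] -/
theorem nonempty_ringHom_symm_of_finrank_eq {i t : I} (g : K i →+* K t) (h : Module.finrank ℚ (K i) = Module.finrank ℚ (K t)) : Nonempty (K t →+* K i) := by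
  have hinj : Function.Injective g.toRatAlgHom.toLinearMap := g.injective
  have hsurj : Function.Surjective g.toRatAlgHom.toLinearMap := (LinearMap.injective_iff_surjective_of_finrank_eq_finrank h).1 hinj
  exact ⟨(AlgEquiv.ofBijective g.toRatAlgHom ⟨hinj, hsurj⟩).symm.toRingEquiv.toRingHom⟩

omit [∀ i, IsCMField (K i)] in
/-- **Transport of «sharing» along a homomorphism on the left**: if a totally complex quadratic subfield of `K_s` embeds in `K_u` and `K_s → K_t` is a homomorphism,
then a totally complex quadratic subfield of `K_t` (the image) embeds in `K_u`. [cite: Shimura1998, §8.4] -/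
theorem sharedQuadratic_of_ringHom_left {s t u : I} (g : K s →+* K t)
    (h : ∃ F : IntermediateField ℚ (K s), Module.finrank ℚ F = 2 ∧ IsTotallyComplex F ∧ Nonempty (F →+* K u)) :
    ∃ F : IntermediateField ℚ (K t), Module.finrank ℚ F = 2 ∧ IsTotallyComplex F ∧ Nonempty (F →+* K u) := by
  obtain ⟨F, hF2, hFtc, ⟨f⟩⟩ := h
  haveI : IsTotallyComplex F := hFtc
  exact exists_quadratic_subfield_of_ringHom_ringHom (k := F) hF2 (g.comp (algebraMap F (K s))) f

/-- **MAIN THEOREM — NO CLOSURE TRIPLE.**  `A_i ⊨ (K_i; Φ_i)` (`i ∈ I` finite) SIMPLE of dimension `≤ 3` such that (A) two distinct sextic slots whose fields share an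
imaginary quadratic field have no ring homomorphism between them, (B) no three pairwise distinct sextic slots have one Galois closure, (iii′) among any three quartic slots
with one Galois closure two carry isogenous surfaces.  Then the Hodge conjecture holds for EVERY product of copies `⨁_j A_{π j}`, GIVEN ONLY Markman's fourfold theorem.  This
CONTAINS W3's theorem ((Q2) there forbids equal closures for non-sharing pairs; here only triples are forbidden).
`HC_CM` is NOT asserted. [cite: MoonenZarhin1999LowDim, Thm. (0.1), Thm. (0.2), §3 (3.1), Cor. (3.9)] [cite: Markman2025SurveySecant, Thm. 1.2]
[cite: Gordon1999HodgeAVSurvey, §3 Theorem (proof), 7.4–7.7, 9.4] [cite: Dodson1984, §5.1.2 Theorem] -/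
theorem hodgeConjectureFor_prod_of_noClosureTriple_of_markman [Fintype I] (hW4 : Markman2025_weilClasses_algebraic_abelianFourfold)
    (hA : ∀ i, IsCMTypeRealisation (Φ i) (A i) (ι i) (θ i)) (hS : ∀ i, (A i).IsSimple) (h3 : ∀ i, (A i).dim ≤ 3)
    (hQ : ∀ t t' : I, t ≠ t' → Module.finrank ℚ (K t) = 6 → Module.finrank ℚ (K t') = 6 →
      (∃ F : IntermediateField ℚ (K t), Module.finrank ℚ F = 2 ∧ IsTotallyComplex F ∧ Nonempty (F →+* K t')) → IsEmpty (K t →+* K t'))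
    (hB : ∀ t t' t'' : I, t ≠ t' → t ≠ t'' → t' ≠ t'' → Module.finrank ℚ (K t) = 6 → Module.finrank ℚ (K t') = 6 → Module.finrank ℚ (K t'') = 6 →
      normalClosure ℚ (K t) ℂ = normalClosure ℚ (K t') ℂ → normalClosure ℚ (K t') ℂ ≠ normalClosure ℚ (K t'') ℂ)
    (hS3 : ∀ x y z : I, Module.finrank ℚ (K x) = 4 → Module.finrank ℚ (K y) = 4 → Module.finrank ℚ (K z) = 4 →
      normalClosure ℚ (K x) ℂ = normalClosure ℚ (K y) ℂ → normalClosure ℚ (K y) ℂ = normalClosure ℚ (K z) ℂ →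
      AbelianVariety.IsIsogenous (A x) (A y) ∨ AbelianVariety.IsIsogenous (A x) (A z) ∨ AbelianVariety.IsIsogenous (A y) (A z))
    {N : ℕ} (π : Fin N → I) : HodgeConjectureFor (⨁ fun j => A (π j)).dim (⨁ fun j => A (π j)).X := by
  classical
  -- «sharing» and the relation «both sextic and (isomorphic fields or sharing)»
  let Sh : I → I → Prop := fun t t' => ∃ F : IntermediateField ℚ (K t), Module.finrank ℚ F = 2 ∧ IsTotallyComplex F ∧ Nonempty (F →+* K t')
  let R : I → I → Prop := fun t t' => Module.finrank ℚ (K t) = 6 ∧ Module.finrank ℚ (K t') = 6 ∧ (Nonempty (K t →+* K t') ∨ Sh t t')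
  have h46 : ∀ t, Module.finrank ℚ (K t) = 6 → ¬ 4 ∣ Module.finrank ℚ (K t) := fun t ht => by rw [ht]; decide
  have hRrefl : ∀ t, Module.finrank ℚ (K t) = 6 → R t t := fun t ht => ⟨ht, ht, Or.inl ⟨RingHom.id _⟩⟩
  have hRsymm : ∀ t t', R t t' → R t' t := by
    rintro t t' ⟨ht, ht', hg | hsh⟩
    · obtain ⟨g⟩ := hg
      exact ⟨ht', ht, Or.inl (nonempty_ringHom_symm_of_finrank_eq g (ht.trans ht'.symm))⟩
    · exact ⟨ht', ht, Or.inr (sharedQuadratic_symm hsh)⟩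
  have hRtrans : ∀ t t' t'', R t t' → R t' t'' → R t t'' := by
    rintro t t' t'' ⟨ht, ht', h₁⟩ ⟨-, ht'', h₂⟩
    refine ⟨ht, ht'', ?_⟩
    rcases h₁ with hg | hsh
    · obtain ⟨g⟩ := hg
      rcases h₂ with hg' | hsh'
      · obtain ⟨g'⟩ := hg'
        exact Or.inl ⟨g'.comp g⟩
      · -- `K_t ≅ K_{t'}` shares what `K_{t'}` shares
        obtain ⟨gi⟩ := nonempty_ringHom_symm_of_finrank_eq g (ht.trans ht'.symm)
        exact Or.inr (sharedQuadratic_of_ringHom_left gi hsh')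
    · rcases h₂ with hg' | hsh'
      · obtain ⟨g'⟩ := hg'
        obtain ⟨F, hF2, hFtc, hf⟩ := hsh
        obtain ⟨f⟩ := hf
        exact Or.inr ⟨F, hF2, hFtc, ⟨g'.comp f⟩⟩
      · exact Or.inr (sharedQuadratic_trans (h46 t' ht') hsh hsh')
  -- in a class, every pair shares as soon as one member has an imaginary quadratic subfield; iso fields have equal closures
  have hL_of_hom : ∀ {t t'}, Module.finrank ℚ (K t) = 6 → Module.finrank ℚ (K t') = 6 → Nonempty (K t →+* K t') →
      normalClosure ℚ (K t) ℂ = normalClosure ℚ (K t') ℂ := fun ht ht' ⟨g⟩ => normalClosure_eq_of_ringHom_of_finrank_eq g (ht.trans ht'.symm)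
  -- the classes as finsets
  let cls : I → Finset I := fun t => Finset.univ.filter (R t)
  have hcls : ∀ t t', Module.finrank ℚ (K t) = 6 → (cls t = cls t' ↔ R t t') := by
    intro t t' ht
    refine ⟨fun h => ?_, fun h => ?_⟩
    · have htt : t ∈ cls t' := by rw [← h]; exact Finset.mem_filter.2 ⟨Finset.mem_univ _, hRrefl t ht⟩
      exact hRsymm _ _ (Finset.mem_filter.1 htt).2
    · ext x
      simp only [cls, Finset.mem_filter, Finset.mem_univ, true_and]
      exact ⟨fun hx => hRtrans _ _ _ (hRsymm _ _ h) hx, fun hx => hRtrans _ _ _ h hx⟩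
  -- the block label of a slot
  let lab : I → Option (Finset I) := fun i => if h : ∃ t, Module.finrank ℚ (K t) = 6 ∧ Nonempty (K i →+* K t) then some (cls (Classical.choose h)) else none
  have hlab : ∀ i t, Module.finrank ℚ (K t) = 6 → Nonempty (K i →+* K t) → lab i = some (cls t) := by
    intro i t ht hg
    have h : ∃ t, Module.finrank ℚ (K t) = 6 ∧ Nonempty (K i →+* K t) := ⟨t, ht, hg⟩
    obtain ⟨ht₀, ⟨g₀⟩⟩ := Classical.choose_spec h
    obtain ⟨g⟩ := hg
    have hlabi : lab i = some (cls (Classical.choose h)) := by simp only [lab, dif_pos h]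
    rw [hlabi, Option.some.injEq, hcls _ _ ht₀]
    -- `R t₀ t`: the slot `i` is a curve through both fields, or a sextic slot isomorphic to both
    rcases finrank_eq_or_of_dim_le_three₃₆n hA (h3 i) with h2 | h4 | h6
    · exact ⟨ht₀, ht, Or.inr (exists_quadratic_subfield_of_ringHom_ringHom (k := K i) h2 g₀ g)⟩
    · exfalso
      have hd := finrank_dvd_of_ringHom₃₆n g
      rw [h4, ht] at hd
      omega
    · obtain ⟨g₀'⟩ := nonempty_ringHom_symm_of_finrank_eq g₀ (h6.trans ht₀.symm)
      exact ⟨ht₀, ht, Or.inl ⟨g.comp g₀'⟩⟩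
  have hlab6 : ∀ t, Module.finrank ℚ (K t) = 6 → lab t = some (cls t) := fun t ht => hlab t t ht ⟨RingHom.id _⟩
  have hlab_none : ∀ i, (¬ ∃ t, Module.finrank ℚ (K t) = 6 ∧ Nonempty (K i →+* K t)) → lab i = none := fun i h => by simp only [lab, dif_neg h]
  -- the blocks
  let D : Type := {o : Option (Finset I) // ∃ i, lab i = o}
  let κ : I → D := fun i => ⟨lab i, i, rfl⟩
  have hκ : Function.Surjective κ := by
    rintro ⟨o, i, rfl⟩
    exact ⟨i, rfl⟩
  have hκne : ∀ i j, κ i ≠ κ j ↔ lab i ≠ lab j := fun i j =>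
    ⟨fun h h' => h (Subtype.ext h'), fun h h' => h (congrArg Subtype.val h')⟩
  -- two sextic slots of different blocks: not related
  have hnotR : ∀ i j, lab i ≠ lab j → Module.finrank ℚ (K i) = 6 → Module.finrank ℚ (K j) = 6 → ¬ R i j := fun i j hne hi hj hR =>
    hne (by rw [hlab6 i hi, hlab6 j hj, (hcls i j hi).2 hR])
  -- a curve of a different block does not map to a sextic field
  have hcurve : ∀ a j, lab a ≠ lab j → Module.finrank ℚ (K a) = 2 → Module.finrank ℚ (K j) = 6 → IsEmpty (K a →+* K j) := fun a j hne h2 hj =>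
    ⟨fun g => hne ((hlab a j hj ⟨g⟩).trans (hlab6 j hj).symm)⟩
  -- the «pairwise» predicate between slots of different blocks, unless a same-closure sextic pair
  have hpair : ∀ i j, lab i ≠ lab j → ¬ (Module.finrank ℚ (K i) = 6 ∧ Module.finrank ℚ (K j) = 6 ∧ normalClosure ℚ (K i) ℂ = normalClosure ℚ (K j) ℂ) →
      (∀ P : Submodule ℚ ((K i →+* ℂ) → ℚ), P ≤ antiSpan (ℂ ≃+* ℂ) (Φ i).1 → (∀ g : ℂ ≃+* ℂ, ∀ f ∈ P, (fun x => f (g • x)) ∈ P) →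
        ∀ T : ((K i →+* ℂ) → ℚ) →ₗ[ℚ] ((K j →+* ℂ) → ℚ), (∀ g : ℂ ≃+* ℂ, ∀ f ∈ P, T (fun x => f (g • x)) = fun y => T f (g • y)) →
          (∀ f ∈ P, T f ∈ antiSpan (ℂ ≃+* ℂ) (Φ j).1) → (∀ f ∈ P, T f = 0 → f = 0) → P = ⊥) := by
    intro i j hne hnot
    rcases finrank_eq_or_of_dim_le_three₃₆n hA (h3 i) with hi2 | hi4 | hi6
    · -- `i` a curve: its field embeds in `K_j` only if the blocks agree
      refine (pairwise_of_isEmpty Φ hi2 ⟨fun g => hne ?_⟩).1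
      rcases finrank_eq_or_of_dim_le_three₃₆n hA (h3 j) with hj2 | hj4 | hj6
      · -- two curves with isomorphic fields lie in the same block
        obtain ⟨g'⟩ := nonempty_ringHom_symm_of_finrank_eq g (hi2.trans hj2.symm)
        by_cases h : ∃ t, Module.finrank ℚ (K t) = 6 ∧ Nonempty (K j →+* K t)
        · obtain ⟨t, ht, ⟨f⟩⟩ := h
          rw [hlab j t ht ⟨f⟩, hlab i t ht ⟨f.comp g⟩]
        · have h' : ¬ ∃ t, Module.finrank ℚ (K t) = 6 ∧ Nonempty (K i →+* K t) := fun ⟨t, ht, ⟨f⟩⟩ => h ⟨t, ht, ⟨f.comp g'⟩⟩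
          rw [hlab_none j h, hlab_none i h']
      · exact ((isEmpty_ringHom_curve_simpleSurface hA hi2 hj4 (hS j)).false g).elim
      · exact ((hcurve i j hne hi2 hj6).false g).elim
    · rcases finrank_eq_or_of_dim_le_three₃₆n hA (h3 j) with hj2 | hj4 | hj6
      · exact (pairwise_of_isEmpty Φ hj2 (isEmpty_ringHom_curve_simpleSurface hA hj2 hi4 (hS i))).2
      · -- two surfaces lie in the same block
        exfalso
        apply hne
        have hi' : ¬ ∃ t, Module.finrank ℚ (K t) = 6 ∧ Nonempty (K i →+* K t) := fun ⟨t, ht, ⟨f⟩⟩ => by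
          have hd := finrank_dvd_of_ringHom₃₆n f; rw [hi4, ht] at hd; omega
        have hj' : ¬ ∃ t, Module.finrank ℚ (K t) = 6 ∧ Nonempty (K j →+* K t) := fun ⟨t, ht, ⟨f⟩⟩ => by
          have hd := finrank_dvd_of_ringHom₃₆n f; rw [hj4, ht] at hd; omega
        rw [hlab_none i hi', hlab_none j hj']
      · exact (pairwise_simple_dim_le_three_of_normalClosure_ne hA hS h3 (fun h => not_normalClosure_le_of_sextic_of_quartic hi4 hj6 h.symm.le)
          (not_exists_quadratic_subfield_of_simpleSurface hA hi4 (hS i) j) (not_exists_quadratic_ringHom_of_simpleSurface hA hi4 (hS i) j)).1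
    · rcases finrank_eq_or_of_dim_le_three₃₆n hA (h3 j) with hj2 | hj4 | hj6
      · exact (pairwise_of_isEmpty Φ hj2 (hcurve j i (Ne.symm hne) hj2 hi6)).2
      · exact (pairwise_simple_dim_le_three_of_normalClosure_ne hA hS h3 (fun h => not_normalClosure_le_of_sextic_of_quartic hj4 hi6 h.le)
          (not_exists_quadratic_ringHom_of_simpleSurface hA hj4 (hS j) i) (not_exists_quadratic_subfield_of_simpleSurface hA hj4 (hS j) i)).1
      · -- two sextic slots of different blocks: no sharing either way; the closures differ since `hnot`
        have hL : normalClosure ℚ (K i) ℂ ≠ normalClosure ℚ (K j) ℂ := fun h => hnot ⟨hi6, hj6, h⟩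
        have hno : ¬ Sh i j := fun h => hnotR i j hne hi6 hj6 ⟨hi6, hj6, Or.inr h⟩
        have hno' : ¬ Sh j i := fun h => hnotR j i (Ne.symm hne) hj6 hi6 ⟨hj6, hi6, Or.inr h⟩
        exact (pairwise_simple_dim_le_three_of_normalClosure_ne hA hS h3 hL hno hno').1
  refine hodgeConjectureFor_prod_of_blocks_of_pairwise_or_nondegeneratePair hA κ hκ (fun i j hij => ?_) (fun d M ρ hρ => ?_) π
  · -- the cross-pair hypothesis
    have hne : lab i ≠ lab j := (hκne i j).1 hij
    by_cases hsame : Module.finrank ℚ (K i) = 6 ∧ Module.finrank ℚ (K j) = 6 ∧ normalClosure ℚ (K i) ℂ = normalClosure ℚ (K j) ℂ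
    · -- an additive exceptional pair: nondegenerate by the census, isolated by (B)
      obtain ⟨hi6, hj6, hL⟩ := hsame
      have hij' : i ≠ j := fun h => hne (by rw [h])
      have hRij : ¬ R i j := hnotR i j hne hi6 hj6
      have hRji : ¬ R j i := hnotR j i (Ne.symm hne) hj6 hi6
      refine Or.inr ⟨?_, fun l hli hlj => ?_⟩
      · -- the pair sub-family is nondegenerate
        let S : Type := {l : I // l = i ∨ l = j}
        haveI : Nonempty S := ⟨⟨i, Or.inl rfl⟩⟩
        have hmem : ∀ a : S, a.1 = i ∨ a.1 = j := fun a => a.2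
        have hniso : ∀ a b : S, a ≠ b → ¬ AbelianVariety.IsIsogenous (A a.1) (A b.1) := by
          intro a b hab hiso
          obtain ⟨e, -⟩ := exists_ringEquiv_forall_mem_iff_of_isIsogenous (hA a.1) (hA b.1) (hS a.1) hiso
          have hab' : a.1 ≠ b.1 := fun h => hab (Subtype.ext h)
          have hn : Nonempty (K a.1 →+* K b.1) := ⟨e.toRingHom⟩
          rcases hmem a with ha | ha <;> rcases hmem b with hb | hb
          · exact hab' (ha.trans hb.symm)
          · rw [ha, hb] at hn
            exact hRij ⟨hi6, hj6, Or.inl hn⟩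
          · rw [ha, hb] at hn
            exact hRji ⟨hj6, hi6, Or.inl hn⟩
          · exact hab' (ha.trans hb.symm)
        refine (isNondegenerateFamily_simpleFamily_dim_le_three_iff (K := fun l : S => K l.1) (Φ := fun l : S => Φ l.1) (A := fun l : S => A l.1)
          (fun l => hA l.1) (fun l => hS l.1) hniso (fun l => h3 l.1)).2 ⟨?_, ?_, ?_⟩
        · intro a b hab
          have hab' : a.1 ≠ b.1 := fun h => hab (Subtype.ext h)
          rcases hmem a with ha | ha <;> rcases hmem b with hb | hb
          · exact absurd (ha.trans hb.symm) hab'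
          · intro h
            apply hRij
            have h' : Sh a.1 b.1 := h
            rw [ha, hb] at h'
            exact ⟨hi6, hj6, Or.inr h'⟩
          · intro h
            apply hRji
            have h' : Sh a.1 b.1 := h
            rw [ha, hb] at h'
            exact ⟨hj6, hi6, Or.inr h'⟩
          · exact absurd (ha.trans hb.symm) hab'
        · intro a _
          have hS2 : (Finset.univ : Finset S).card ≤ 2 := by
            have h := Finset.card_le_card_of_injOn (s := (Finset.univ : Finset S)) (t := ({i, j} : Finset I)) (fun a : S => a.1)
              (fun a _ => by
                show a.1 ∈ ({i, j} : Finset I)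
                rcases hmem a with h | h <;> simp [h])
              (fun a _ b _ hab => Subtype.ext hab)
            exact h.trans Finset.card_le_two
          calc (Finset.univ.filter fun b : S => Nonempty (K b.1 ≃+* K a.1)).card ≤ (Finset.univ : Finset S).card := Finset.card_filter_le _ _
            _ ≤ 3 := hS2.trans (by norm_num)
        · intro a ha4
          exfalso
          rcases hmem a with ha | ha
          · have : Module.finrank ℚ (K a.1) = 6 := by rw [ha]; exact hi6
            omega
          · have : Module.finrank ℚ (K a.1) = 6 := by rw [ha]; exact hj6
            omega
      · -- isolation: a third slot `l` is foreign to `i` or to `j`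
        rcases finrank_eq_or_of_dim_le_three₃₆n hA (h3 l) with hl2 | hl4 | hl6
        · -- a curve through at most one of the two fields
          by_cases hli' : Nonempty (K l →+* K i)
          · have hlj' : IsEmpty (K l →+* K j) := ⟨fun g => by
              obtain ⟨f⟩ := hli'
              exact hRij ⟨hi6, hj6, Or.inr (exists_quadratic_subfield_of_ringHom_ringHom (k := K l) hl2 f g)⟩⟩
            exact Or.inr (pairwise_of_isEmpty Φ hl2 hlj').2
          · exact Or.inl (pairwise_of_isEmpty Φ hl2 (not_nonempty_iff.1 hli')).2
        · exact Or.inl (pairwise_simple_dim_le_three_of_normalClosure_ne hA hS h3 (fun h => not_normalClosure_le_of_sextic_of_quartic hl4 hi6 h.le)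
            (not_exists_quadratic_ringHom_of_simpleSurface hA hl4 (hS l) i) (not_exists_quadratic_subfield_of_simpleSurface hA hl4 (hS l) i)).1
        · -- a third sextic slot: its closure differs by (B); it shares with at most one of `i`, `j`
          have hLl : normalClosure ℚ (K l) ℂ ≠ normalClosure ℚ (K i) ℂ := fun h =>
            hB i j l hij' (Ne.symm hli) (Ne.symm hlj) hi6 hj6 hl6 hL (hL.symm.trans h.symm)
          by_cases hshil : Sh i l
          · -- then `¬ Sh j l`, else `i` and `j` would share
            have hshjl : ¬ Sh j l := fun h => hRij ⟨hi6, hj6, Or.inr (sharedQuadratic_trans (h46 l hl6) hshil (sharedQuadratic_symm h))⟩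
            have hshlj : ¬ Sh l j := fun h => hshjl (sharedQuadratic_symm h)
            exact Or.inr (pairwise_simple_dim_le_three_of_normalClosure_ne hA hS h3 (fun h => hLl (h.symm.trans hL.symm)) hshjl hshlj).1
          · have hshli : ¬ Sh l i := fun h => hshil (sharedQuadratic_symm h)
            exact Or.inl (pairwise_simple_dim_le_three_of_normalClosure_ne hA hS h3 (Ne.symm hLl) hshil hshli).1
    · exact Or.inl (hpair i j hne hsame)
  · -- the Hodge conjecture inside the block `d`
    obtain ⟨o, i₀, hi₀⟩ := d
    have hρ' : ∀ l, lab (ρ l) = o := fun l => by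
      have h := congrArg Subtype.val (hρ l)
      exact h
    cases M with
    | zero => exact hodgeConjectureFor_of_isDivisorGenerated _ (isDivisorGenerated_of_dim_eq_zero _ (dim_biproduct_fin_zero _))
    | succ M =>
      rcases o with _ | c
      · -- the block of surfaces and free curves
        refine hodgeConjectureFor_prod_surfaceBlock_of_closures hA hS h3 hS3 ρ fun l h6 => ?_
        have h := hρ' l
        rw [hlab6 (ρ l) h6] at h
        exact Option.some_ne_none _ h
      · -- a block of threefolds and their curves: `c = cls t₀` for a sextic `t₀`
        obtain ⟨t₀, ht₀, hc⟩ : ∃ t₀, Module.finrank ℚ (K t₀) = 6 ∧ lab (ρ 0) = some (cls t₀) := by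
          by_cases h : ∃ t, Module.finrank ℚ (K t) = 6 ∧ Nonempty (K (ρ 0) →+* K t)
          · obtain ⟨t, ht, hg⟩ := h
            exact ⟨t, ht, hlab _ t ht hg⟩
          · exact absurd ((hlab_none _ h).symm.trans (hρ' 0)) (by simp)
        have hco : some (cls t₀) = some c := hc.symm.trans (hρ' 0)
        -- every member: a curve through a field of the class, or a sextic slot of the class
        have hmem : ∀ l, (Module.finrank ℚ (K (ρ l)) = 2 ∧ ∃ t, Module.finrank ℚ (K t) = 6 ∧ Nonempty (K (ρ l) →+* K t) ∧ R t₀ t) ∨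
            (Module.finrank ℚ (K (ρ l)) = 6 ∧ R t₀ (ρ l)) := by
          intro l
          have hl : lab (ρ l) = some (cls t₀) := (hρ' l).trans hco.symm
          by_cases h : ∃ t, Module.finrank ℚ (K t) = 6 ∧ Nonempty (K (ρ l) →+* K t)
          · obtain ⟨t, ht, hg⟩ := h
            have hct : cls t = cls t₀ := by
              have h1 := (hlab _ t ht hg).symm.trans hl
              exact Option.some.inj h1
            have hRt : R t₀ t := hRsymm _ _ ((hcls t t₀ ht).1 hct)
            rcases finrank_eq_or_of_dim_le_three₃₆n hA (h3 (ρ l)) with h2 | h4 | h6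
            · exact Or.inl ⟨h2, t, ht, hg, hRt⟩
            · exfalso
              obtain ⟨g⟩ := hg
              have hd := finrank_dvd_of_ringHom₃₆n g; rw [h4, ht] at hd; omega
            · refine Or.inr ⟨h6, hRtrans _ _ _ hRt (hRsymm _ _ ⟨h6, ht, Or.inl hg⟩)⟩
          · exact absurd ((hlab_none _ h).symm.trans hl) (by simp)
        by_cases hK : ∃ F : IntermediateField ℚ (K t₀), Module.finrank ℚ F = 2 ∧ IsTotallyComplex F
        · -- (ii) a GROUP through the imaginary quadratic field `F₀ ≤ K_{t₀}`
          obtain ⟨F₀, hF₀2, hF₀tc⟩ := hK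
          haveI : IsTotallyComplex F₀ := hF₀tc
          haveI : IsCMField F₀ := isCMField_of_isTotallyComplex_of_finrank_two hF₀2
          let s : Finset I := Finset.univ.filter fun t => R t₀ t
          let e : Fin s.card → I := fun m => (s.equivFin.symm m).1
          have he_mem : ∀ m, R t₀ (e m) := fun m => (Finset.mem_filter.1 (s.equivFin.symm m).2).2
          have he_inj : Function.Injective e := fun m m' h => s.equivFin.symm.injective (Subtype.ext h)
          have he_surj : ∀ t, R t₀ t → ∃ m, t = e m := fun t ht =>
            ⟨s.equivFin ⟨t, Finset.mem_filter.2 ⟨Finset.mem_univ _, ht⟩⟩, by simp only [e, Equiv.symm_apply_apply]⟩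
          -- `F₀` embeds in every field of the class
          have hF₀emb : ∀ t, R t₀ t → Nonempty (F₀ →+* K t) := by
            rintro t ⟨-, -, hg | hsh⟩
            · obtain ⟨g⟩ := hg
              exact ⟨g.comp (algebraMap F₀ (K t₀))⟩
            · exact nonempty_ringHom_of_sharedQuadratic (h46 t₀ ht₀) F₀ hF₀2 hsh
          let i : ∀ m, F₀ →+* K (e m) := fun m => Classical.choice (hF₀emb _ (he_mem m))
          obtain ⟨τ⟩ : Nonempty (F₀ →+* ℂ) := inferInstance
          -- pairwise no homomorphisms inside the class, by (A)
          have hiso : ∀ m₀ m : Fin s.card, m₀ ≠ m → IsEmpty (K (e m) →+* K (e m₀)) := by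
            intro m₀ m hm
            have hne : e m ≠ e m₀ := fun h => hm (he_inj h).symm
            exact hQ (e m) (e m₀) hne (he_mem m).2.1 (he_mem m₀).2.1 (exists_quadratic_subfield_of_ringHom_ringHom hF₀2 (i m) (i m₀))
          refine hodgeConjectureFor_prod_groupBlock_of_isEmpty_ringHom hW4 hA hS e (fun m => (he_mem m).2.1) hF₀2 i τ hiso ρ fun l => ?_
          rcases hmem l with ⟨h2, t, ht, hg, hRt⟩ | ⟨h6, hRl⟩
          · obtain ⟨m, rfl⟩ := he_surj t hRt
            exact Or.inl ⟨h2, m, hg⟩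
          · exact Or.inr (he_surj (ρ l) hRl)
        · -- (i) at most two slots of ONE field without imaginary quadratic subfield, no curve
          have hiso_of_R : ∀ t, R t₀ t → Nonempty (K t₀ →+* K t) := by
            rintro t ⟨-, -, hg | hsh⟩
            · exact hg
            · obtain ⟨F, hF2, hFtc, -⟩ := hsh
              exact absurd ⟨F, hF2, hFtc⟩ hK
          have hLR : ∀ t, R t₀ t → normalClosure ℚ (K t₀) ℂ = normalClosure ℚ (K t) ℂ := fun t hRt => hL_of_hom ht₀ hRt.2.1 (hiso_of_R t hRt)
          -- a second member `t₁` (possibly `t₀`) such that the class is `{t₀, t₁}`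
          obtain ⟨t₁, ht₁, hcov⟩ : ∃ t₁, Module.finrank ℚ (K t₁) = 6 ∧ ∀ t, R t₀ t → t = t₀ ∨ t = t₁ := by
            by_cases hT : ∃ t, R t₀ t ∧ t ≠ t₀
            · obtain ⟨t₁, hR₁, hne₁⟩ := hT
              refine ⟨t₁, hR₁.2.1, fun t hRt => ?_⟩
              by_contra hnot
              push Not at hnot
              exact hB t₀ t₁ t (Ne.symm hne₁) (Ne.symm hnot.1) (Ne.symm hnot.2) ht₀ hR₁.2.1 hRt.2.1 (hLR t₁ hR₁) ((hLR t₁ hR₁).symm.trans (hLR t hRt))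
            · exact ⟨t₀, ht₀, fun t hRt => Or.inl (by by_contra h; exact hT ⟨t, hRt, h⟩)⟩
          refine hodgeConjectureFor_prod_threefoldBlock_of_markman hW4 hA hS ht₀ ht₁ ρ fun l => ?_
          rcases hmem l with ⟨h2, t, ht, ⟨g⟩, hRt⟩ | ⟨h6, hRl⟩
          · -- a curve inside a field of the class would give `K_{t₀}` an imaginary quadratic subfield
            exfalso
            obtain ⟨g₀⟩ := hiso_of_R t hRt
            obtain ⟨g₀'⟩ := nonempty_ringHom_symm_of_finrank_eq g₀ (ht₀.trans ht.symm)
            obtain ⟨F, hF2, hFtc, -⟩ := exists_quadratic_subfield_of_ringHom_ringHom (k := K (ρ l)) h2 (g₀'.comp g) (g₀'.comp g)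
            exact hK ⟨F, hF2, hFtc⟩
          · exact Or.inr (hcov (ρ l) hRl)

/-- **Dominated form.** [cite: MoonenZarhin1999LowDim, Thm. (0.1), (0.2)] [cite: Markman2025SurveySecant, Thm. 1.2] [cite: MumfordAV1970, §19 Thm. 1 and p. 169] -/
theorem hodgeConjectureFor_of_avDominatedBy_prod_of_noClosureTriple_of_markman [Fintype I] (hW4 : Markman2025_weilClasses_algebraic_abelianFourfold)
    (hA : ∀ i, IsCMTypeRealisation (Φ i) (A i) (ι i) (θ i)) (hS : ∀ i, (A i).IsSimple) (h3 : ∀ i, (A i).dim ≤ 3)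
    (hQ : ∀ t t' : I, t ≠ t' → Module.finrank ℚ (K t) = 6 → Module.finrank ℚ (K t') = 6 →
      (∃ F : IntermediateField ℚ (K t), Module.finrank ℚ F = 2 ∧ IsTotallyComplex F ∧ Nonempty (F →+* K t')) → IsEmpty (K t →+* K t'))
    (hB : ∀ t t' t'' : I, t ≠ t' → t ≠ t'' → t' ≠ t'' → Module.finrank ℚ (K t) = 6 → Module.finrank ℚ (K t') = 6 → Module.finrank ℚ (K t'') = 6 →
      normalClosure ℚ (K t) ℂ = normalClosure ℚ (K t') ℂ → normalClosure ℚ (K t') ℂ ≠ normalClosure ℚ (K t'') ℂ)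
    (hS3 : ∀ x y z : I, Module.finrank ℚ (K x) = 4 → Module.finrank ℚ (K y) = 4 → Module.finrank ℚ (K z) = 4 →
      normalClosure ℚ (K x) ℂ = normalClosure ℚ (K y) ℂ → normalClosure ℚ (K y) ℂ = normalClosure ℚ (K z) ℂ →
      AbelianVariety.IsIsogenous (A x) (A y) ∨ AbelianVariety.IsIsogenous (A x) (A z) ∨ AbelianVariety.IsIsogenous (A y) (A z))
    {N : ℕ} (π : Fin N → I) {X : AbelianVariety ℂ} (hX : Domination.AVDominatedBy X (⨁ fun j => A (π j))) : HodgeConjectureFor X.dim X.X :=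
  Domination.hodgeConjectureFor_of_avDominatedBy (hodgeConjectureFor_prod_of_noClosureTriple_of_markman hW4 hA hS h3 hQ hB hS3 π) hX

end Summit.HodgeConjecture.CorCM.MultiFieldWeil

end
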